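import Mathlib

/-!
# Manin–Gamma cell (pub-manin-gamma0): the mod-8 arithmetic endgame of T1, machine-checked (seat p1)

These are the three elementary congruence lemmas that close §5 of `proofs/T1_lead.md`
(square-class bookkeeping, Options 2 and 3) and the binomial congruence behind Lemma 4.3 / GDK F.5
(`U_M ⊆ H′`).  Statements are over `ℤ`; proofs reduce to `ZMod 8` and finite verification.

* `ManinGamma.opt2_parity` : `a² + p b² = 2 m²`, `p ≡ 3 (mod 4)`, `a, b` not both even
   ⟹ `a, b` odd, `m` even, `p ≡ 7 (mod 8)`  (T1_lead §5, Option 2, last paragraph).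
* `ManinGamma.no_sol_sq_sub_psq` : `α² − p γ² = β²` has no solution with `α, γ` odd, `p ≡ 3 (mod 4)`
   (T1_lead §5, Option 3, sub-case `k_P = (2,2p,p)`; review/ALGEBRA_TATE_p1 §3 first sub-case).
* `ManinGamma.no_pyth_odd_odd` : `α² + γ² = δ²` has no solution with `α, γ` odd
   (T1_lead §5, Option 3, sub-case `k_P = 1`; review/ALGEBRA_TATE_p1 §3 second sub-case).
* `ManinGamma.one_add_pow_modEq_sq` : `(1 + M)^k ≡ 1 + k M (mod M²)` (Lemma 4.3 / GDK F.5).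
-/

namespace ManinGamma

/-- Finite core of `opt2_parity`, `p ≡ 3 (mod 8)`: the congruence `a² + 3b² ≡ 2m² (mod 8)` forces
`a` and `b` even (encoded as `4a = 0`, `4b = 0` in `ZMod 8`). -/
theorem aux_opt2_three : ∀ a b m : ZMod 8, a ^ 2 + 3 * b ^ 2 = 2 * m ^ 2 → 4 * a = 0 ∧ 4 * b = 0 := by
  decide

/-- Finite core of `opt2_parity`, `p ≡ 7 (mod 8)`: `a² + 7b² ≡ 2m² (mod 8)` forces either `a, b` both even,
or `a, b` both odd and `m` even. -/
theorem aux_opt2_seven : ∀ a b m : ZMod 8, a ^ 2 + 7 * b ^ 2 = 2 * m ^ 2 →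
    (4 * a = 0 ∧ 4 * b = 0) ∨ (4 * a = 4 ∧ 4 * b = 4 ∧ 4 * m = 0) := by
  decide

/-- Finite core of `no_sol_sq_sub_psq`: for `p ∈ {3, 7} (mod 8)` and `α, γ` odd,
`α² − pγ²` is not a square mod 8. -/
theorem aux_opt3a : ∀ α β γ : ZMod 8, 4 * α = 4 → 4 * γ = 4 →
    α ^ 2 - 3 * γ ^ 2 ≠ β ^ 2 ∧ α ^ 2 - 7 * γ ^ 2 ≠ β ^ 2 := by
  decide

/-- Finite core of `no_pyth_odd_odd`: two odd squares never sum to a square mod 8. -/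
theorem aux_opt3b : ∀ α γ δ : ZMod 8, 4 * α = 4 → 4 * γ = 4 → α ^ 2 + γ ^ 2 ≠ δ ^ 2 := by
  decide

/-- Transfer: `4·a = 0` in `ZMod 8` iff `a` is even. -/
theorem four_mul_cast_eq_zero_iff (a : ℤ) : (4 : ZMod 8) * (a : ZMod 8) = 0 ↔ Even a := by
  have h : ((4 * a : ℤ) : ZMod 8) = 4 * (a : ZMod 8) := by push_cast; ring
  rw [← h, ZMod.intCast_zmod_eq_zero_iff_dvd, Int.even_iff]
  constructor
  · intro hd; omega
  · intro he; exact ⟨a / 2, by omega⟩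

/-- Transfer: `4·a = 4` in `ZMod 8` iff `a` is odd. -/
theorem four_mul_cast_eq_four_iff (a : ℤ) : (4 : ZMod 8) * (a : ZMod 8) = 4 ↔ Odd a := by
  have h : ((4 * a - 4 : ℤ) : ZMod 8) = 4 * (a : ZMod 8) - 4 := by push_cast; ring
  rw [← sub_eq_zero, ← h, ZMod.intCast_zmod_eq_zero_iff_dvd, Int.odd_iff]
  constructor
  · intro hd; omega
  · intro ho; exact ⟨(a - 1) / 2, by omega⟩

/-- Transfer: the residue of `p` in `ZMod 8` from `p % 8`. -/
theorem cast_eq_of_emod_eq (p : ℤ) (r : ℤ) (h : p % 8 = r) : (p : ZMod 8) = (r : ZMod 8) := by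
  have : ((p % (8 : ℕ) : ℤ) : ZMod 8) = (p : ZMod 8) := ZMod.intCast_mod p 8
  rw [← this]
  exact_mod_cast congrArg (fun x : ℤ => (x : ZMod 8)) h

/-- **Option 2 parity lemma** (T1_lead §5). If `a² + p·b² = 2·m²` with `p ≡ 3 (mod 4)` and `a, b` not both
even, then `a` and `b` are odd, `m` is even and `p ≡ 7 (mod 8)`. -/
theorem opt2_parity (a b m p : ℤ) (hp : p % 4 = 3) (hab : ¬ (Even a ∧ Even b))
    (h : a ^ 2 + p * b ^ 2 = 2 * m ^ 2) : Odd a ∧ Odd b ∧ Even m ∧ p % 8 = 7 := by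
  have h8 : ((a ^ 2 + p * b ^ 2 : ℤ) : ZMod 8) = ((2 * m ^ 2 : ℤ) : ZMod 8) := by rw [h]
  push_cast at h8
  have hp8 : p % 8 = 3 ∨ p % 8 = 7 := by omega
  rcases hp8 with hp3 | hp7
  · exfalso
    have hc : (p : ZMod 8) = 3 := by simpa using cast_eq_of_emod_eq p 3 hp3
    rw [hc] at h8
    obtain ⟨ha, hb⟩ := aux_opt2_three _ _ _ h8
    exact hab ⟨(four_mul_cast_eq_zero_iff a).1 ha, (four_mul_cast_eq_zero_iff b).1 hb⟩
  · have hc : (p : ZMod 8) = 7 := by simpa using cast_eq_of_emod_eq p 7 hp7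
    rw [hc] at h8
    rcases aux_opt2_seven _ _ _ h8 with ⟨ha, hb⟩ | ⟨ha, hb, hm⟩
    · exact absurd ⟨(four_mul_cast_eq_zero_iff a).1 ha, (four_mul_cast_eq_zero_iff b).1 hb⟩ hab
    · exact ⟨(four_mul_cast_eq_four_iff a).1 ha, (four_mul_cast_eq_four_iff b).1 hb,
        (four_mul_cast_eq_zero_iff m).1 hm, hp7⟩

/-- **Option 3, first sub-case** (T1_lead §5): `α² − p·γ² = β²` is impossible for `α, γ` odd and
`p ≡ 3 (mod 4)`. -/
theorem no_sol_sq_sub_psq (α β γ p : ℤ) (hα : Odd α) (hγ : Odd γ) (hp : p % 4 = 3) :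
    α ^ 2 - p * γ ^ 2 ≠ β ^ 2 := by
  intro h
  have h8 : ((α ^ 2 - p * γ ^ 2 : ℤ) : ZMod 8) = ((β ^ 2 : ℤ) : ZMod 8) := by rw [h]
  push_cast at h8
  have hα' := (four_mul_cast_eq_four_iff α).2 hα
  have hγ' := (four_mul_cast_eq_four_iff γ).2 hγ
  obtain ⟨h3, h7⟩ := aux_opt3a (α : ZMod 8) (β : ZMod 8) (γ : ZMod 8) hα' hγ'
  have hp8 : p % 8 = 3 ∨ p % 8 = 7 := by omega
  rcases hp8 with hp3 | hp7
  · have hc : (p : ZMod 8) = 3 := by simpa using cast_eq_of_emod_eq p 3 hp3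
    rw [hc] at h8; exact h3 h8
  · have hc : (p : ZMod 8) = 7 := by simpa using cast_eq_of_emod_eq p 7 hp7
    rw [hc] at h8; exact h7 h8

/-- **Option 3, second sub-case** (T1_lead §5): two odd squares never add up to a square. -/
theorem no_pyth_odd_odd (α γ δ : ℤ) (hα : Odd α) (hγ : Odd γ) : α ^ 2 + γ ^ 2 ≠ δ ^ 2 := by
  intro h
  have h8 : ((α ^ 2 + γ ^ 2 : ℤ) : ZMod 8) = ((δ ^ 2 : ℤ) : ZMod 8) := by rw [h]
  push_cast at h8
  exact aux_opt3b _ _ _ ((four_mul_cast_eq_four_iff α).2 hα) ((four_mul_cast_eq_four_iff γ).2 hγ) h8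

/-- **Binomial congruence** behind Lemma 4.3 / GDK F.5: `(1 + M)^k ≡ 1 + k·M (mod M²)`; with `N ∣ M²`
this gives `(1 + M)^k ≡ 1 + kM (mod N)`, i.e. `U_M = ⟨1 + M⟩` inside `(ℤ/N)^×`. -/
theorem one_add_pow_modEq_sq (M : ℤ) (k : ℕ) : (1 + M) ^ k ≡ 1 + (k : ℤ) * M [ZMOD M ^ 2] := by
  induction k with
  | zero => simp
  | succ k ih =>
    have step : (1 + M) ^ (k + 1) = (1 + M) ^ k * (1 + M) := pow_succ _ _
    rw [step]
    have h1 : (1 + M) ^ k * (1 + M) ≡ (1 + (k : ℤ) * M) * (1 + M) [ZMOD M ^ 2] := ih.mul_right _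
    have h2 : (1 + (k : ℤ) * M) * (1 + M) = (1 + ((k + 1 : ℕ) : ℤ) * M) + (k : ℤ) * M ^ 2 := by
      push_cast; ring
    have h3 : (1 + ((k + 1 : ℕ) : ℤ) * M) + (k : ℤ) * M ^ 2 ≡ 1 + ((k + 1 : ℕ) : ℤ) * M [ZMOD M ^ 2] := by
      have hz : (k : ℤ) * M ^ 2 ≡ 0 [ZMOD M ^ 2] :=
        (Int.modEq_zero_iff_dvd.2 (dvd_mul_left _ _))
      have h4 := (Int.ModEq.refl (1 + ((k + 1 : ℕ) : ℤ) * M)).add hz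
      simp only [add_zero] at h4
      exact h4
    exact (h1.trans (by rw [h2])).trans h3

/-- The parabolic matrix of Lemma 4.3 / GDK F.5 has determinant one: with `N = t²·h` and `M = t·h`,
`det ((1−M, h), (−N, 1+M)) = (1−M)(1+M) + h·N = 1`. -/
theorem parabolic_det (t h : ℤ) : (1 - t * h) * (1 + t * h) - h * (-(t ^ 2 * h)) = 1 := by
  ring

end ManinGamma
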